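import Mathlib
import HarnessLib

/-!
# Ring bookkeeping for the graded core (`stub_depthX9`, line `graded_euler_loss`, crux `KatoDivisibilityX9` =
# stmt-BirchSwinnertonDyer-20547): the quotient `R[X]/(g)` by a MONIC `g` is a Frobenius (Gorenstein) `R`-algebra,
# `ann(ω) = (ω)` in `R[X]/(ω²)`, and `a • M ≅ M / b • M` for a free module over a ring with `ann(a) = (b)`
# (e.g. `p^n • A ≅ A / p • A` over `ℤ/p^{n+1}`)

Seat `bsd-line-k6-p4` (prover-bsd-line-k6-p4-g3-0; D-0154 KEY (146) row 9; route `OneSidedTwistSqueezeX9`; host cell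
`bsd-f3-mu`).  THEOREMS ONLY, sorry-free: pure commutative algebra (no definition, no named fact, nothing asserted
about any curve).  `--supports stmt-BirchSwinnertonDyer-20547 --as helper` (0 stub credit).

WHERE IT SITS.  The registered stub `stub_depthX9 : SIM.FineExponentLeEulerLossOnClassX9` (ES-C4) for `n ≥ 1` is the
port of the cell's `n = 0` core theorem from the ring `Ω/T^{2e} = Λ/(p, ω²)` to `A := Λ/(p^{n+1}, ω²)`
(HOME(bsd-f3-mu)/MEMO-es.md §15, RING paragraph and step S4; §21 (A2), (A6)).  The blueprint uses exactly three facts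
about `A` beyond those of `Ω/T^{2e}`: (R1) `A` is free over `ℤ/p^{n+1}` of rank `2e` and **Gorenstein**: `A^∨ :=
Hom_{ℤ/p^{n+1}}(A, ℤ/p^{n+1}) ≅ A` as `A`-modules — used in S4 to turn a surjection `𝒮_d^∨ ↠ A` into an element of
`𝒮_d[ω²]`; (R2) `ann_A(ω) = ωA` — used in STEP 3 (`ω · ω𝕋_A = 0`, well-definedness of `κ_q(σ̄)`); (R3)
`p^n A ≅ A/pA = Ω/T^{2e}` — the transport `p^d ω A = ι(T^e Ā)` of STEP 4.  With `ω = (1+T)^{p^{m₀−1}} − 1` a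
distinguished (monic) polynomial, `A = (ℤ/p^{n+1})[X]/(ω̄²)` is `AdjoinRoot` of a monic polynomial over the finite
ring `R = ℤ/p^{n+1}`, so the three facts are instances of the general statements proved here:

* §1 `AdjoinRoot` of a monic `g` of degree `d ≥ 1` over any commutative ring `R`: the `R`-linear functional
  `λ = (coefficient of X^{d−1}) ∘ (reduction mod g)` (`Polynomial.lcoeff R (d-1) ∘ AdjoinRoot.modByMonicHom`) makes
  `(a, b) ↦ λ(ab)` a non-degenerate symmetric pairing: `exists_lcoeff_modByMonic_mul_ne_zero` (every `a ≠ 0` pairs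
  non-trivially with some power of the root), `eq_zero_of_forall_lcoeff_modByMonic_mul_eq_zero`, and over a FINITE
  `R` the map `a ↦ λ(a·)` is a bijection `A → Hom_R(A, R)` (`bijective_frobeniusForm_of_finite`) — (R1).
* §2 `mk_mul_eq_zero_iff_dvd_of_monic` / `annihilator_of_monic_sq`: for monic `ω`, in `R[X]/(ω²)` one has
  `ω̄ · ḡ = 0 ↔ ω ∣ g`, i.e. `ann(ω̄) = (ω̄)` — (R2).
* §3 `smul_eq_zero_iff_mem_smul_top_of_free` / `nonempty_quotSMulTop_linearEquiv_smulTop`: for a free `R`-module `M` and `a, b ∈ R`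
  with `a x = 0 ↔ b ∣ x` in `R`, `a • m = 0 ↔ m ∈ b • M`, hence `M / bM ≃ₗ[R] a • M`; and
  `ZMod.pow_mul_eq_zero_iff_dvd` (`p^n x = 0 ↔ p ∣ x` in `ℤ/p^{n+1}`) — (R3).

HONEST LABEL: bookkeeping only; `stub_depthX9` (`n ≥ 1`), `stub_widthX9` and the crux stay OPEN; the carriers of the
port (T-es-6) are not in the tree; PARTITION untouched; beyond-print theorem toward BSD: NO; no summit statement is
proved by this seat; BSD is not proved by any of this.

References: HOME(bsd-f3-mu)/MEMO-es.md §15 (RING, S4), §21 (A2), (A6); L. Washington, GTM 83, Prop. 13.8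
[Washington1997]; S. Lang, *Cyclotomic Fields I–II*, Ch. 5 §2 Thm. 2.1 [Lang1980]; B. Mazur, K. Rubin, Mem. AMS 799
(2004) §5.3 (the principal Artinian coefficient rings) [MazurRubin2004].
-/

-- the summit and its single problem are both named `BirchSwinnertonDyer` (registry layout D-0017)
set_option linter.dupNamespace false

set_option autoImplicit false

open Polynomial

namespace Summit.BirchSwinnertonDyer.BirchSwinnertonDyer.Rank1Residual.GradedRing

/-! ## §1 The Frobenius form on `R[X]/(g)` for monic `g` -/

section Frobenius

variable {R : Type*} [CommRing R] {g : R[X]}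

/-- The functional `λ = lcoeff (d-1) ∘ modByMonicHom` evaluated on the class of a polynomial `f` of degree `< d`
is the coefficient of `X^{d-1}` in `f` itself. [folklore] -/
theorem lcoeff_modByMonicHom_mk_of_degree_lt (hg : g.Monic) {f : R[X]} (hf : f.degree < g.degree) :
    ((Polynomial.lcoeff R (g.natDegree - 1)).comp (AdjoinRoot.modByMonicHom hg)) (AdjoinRoot.mk g f) =
      f.coeff (g.natDegree - 1) := by
  nontriviality R
  rw [LinearMap.comp_apply, AdjoinRoot.modByMonicHom_mk, (Polynomial.modByMonic_eq_self_iff hg).mpr hf,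
    Polynomial.lcoeff_apply]

/-- **Non-degeneracy of the Frobenius form (every non-zero class pairs non-trivially with a power of the root).**
For `g` monic of degree `d ≥ 1` and `a ≠ 0` in `R[X]/(g)`: writing `a` as the class of its reduced representative
`r` (`deg r = j < d`), the product `a · X^{d-1-j}` is the class of `r · X^{d-1-j}`, of degree `d − 1`, whose
`X^{d-1}`-coefficient is the leading coefficient of `r`, hence `≠ 0`. [folklore] -/
theorem exists_lcoeff_modByMonic_mul_ne_zero (hg : g.Monic) (hd : 0 < g.natDegree) {a : AdjoinRoot g}
    (ha : a ≠ 0) :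
    ∃ k : ℕ, k < g.natDegree ∧
      ((Polynomial.lcoeff R (g.natDegree - 1)).comp (AdjoinRoot.modByMonicHom hg))
        (a * AdjoinRoot.mk g (X ^ k)) ≠ 0 := by
  rcases subsingleton_or_nontrivial R with hR | hR
  · haveI := Module.subsingleton R (AdjoinRoot g)
    exact absurd (Subsingleton.elim a 0) ha
  -- the reduced representative
  set r : R[X] := AdjoinRoot.modByMonicHom hg a with hr
  have har : AdjoinRoot.mk g r = a := AdjoinRoot.mk_leftInverse hg a
  have hr0 : r ≠ 0 := by
    intro h
    apply ha
    rw [← har, h, map_zero]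
  have hrdeg : r.degree < g.degree := by
    obtain ⟨q, rfl⟩ := AdjoinRoot.mk_surjective a
    rw [hr, AdjoinRoot.modByMonicHom_mk]
    exact Polynomial.degree_modByMonic_lt q hg
  have hrnat : r.natDegree < g.natDegree := Polynomial.natDegree_lt_natDegree hr0 hrdeg
  set k : ℕ := g.natDegree - 1 - r.natDegree with hk
  refine ⟨k, by omega, ?_⟩
  have hidx : g.natDegree - 1 = r.natDegree + k := by omega
  rw [← har, ← map_mul, lcoeff_modByMonicHom_mk_of_degree_lt hg, hidx, Polynomial.coeff_mul_X_pow]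
  · exact fun h => hr0 (Polynomial.leadingCoeff_eq_zero.mp h)
  · rw [Polynomial.degree_eq_natDegree hg.ne_zero, Polynomial.degree_lt_iff_coeff_zero]
    intro m hm
    have hm' : g.natDegree ≤ m := by exact_mod_cast hm
    rw [Polynomial.coeff_mul_X_pow', if_pos (by omega)]
    exact Polynomial.coeff_eq_zero_of_natDegree_lt (by omega)

/-- **The Frobenius form is (left-)non-degenerate:** if `λ(a · b) = 0` for all `b`, then `a = 0`. [folklore] -/
theorem eq_zero_of_forall_lcoeff_modByMonic_mul_eq_zero (hg : g.Monic) (hd : 0 < g.natDegree)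
    {a : AdjoinRoot g}
    (h : ∀ b : AdjoinRoot g,
      ((Polynomial.lcoeff R (g.natDegree - 1)).comp (AdjoinRoot.modByMonicHom hg)) (a * b) = 0) :
    a = 0 := by
  by_contra ha
  obtain ⟨k, -, hk⟩ := exists_lcoeff_modByMonic_mul_ne_zero hg hd ha
  exact hk (h _)

/-- **The Frobenius form as a map `A → Hom_R(A, R)`, `a ↦ (b ↦ λ(ab))`, is injective** (`A = R[X]/(g)`, `g` monic
of degree `≥ 1`). [folklore] -/
theorem injective_frobeniusForm (hg : g.Monic) (hd : 0 < g.natDegree) :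
    Function.Injective
      ((LinearMap.mul R (AdjoinRoot g)).compr₂
        ((Polynomial.lcoeff R (g.natDegree - 1)).comp (AdjoinRoot.modByMonicHom hg))) := by
  intro a a' haa'
  rw [← sub_eq_zero]
  refine eq_zero_of_forall_lcoeff_modByMonic_mul_eq_zero hg hd fun b => ?_
  have := congrArg (fun φ : AdjoinRoot g →ₗ[R] R => φ b) haa'
  simp only [LinearMap.compr₂_apply, LinearMap.mul_apply'] at this
  rw [sub_mul, map_sub, sub_eq_zero]
  exact this

/-- **(R1) Gorenstein / Frobenius duality over a FINITE coefficient ring:** for `R` finite and `g` monic of degree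
`d ≥ 1`, `a ↦ λ(a·)` is a BIJECTION `R[X]/(g) → Hom_R(R[X]/(g), R)` — both sides are free of rank `d` over the finite
ring `R`, so the injective map between finite sets of equal size is onto.  (The map is `A`-linear for the
`A`-module structure `(a·φ)(b) = φ(ab)` on the dual, so this is `A^∨ ≅ A`; only the bijection is recorded.)
[cite: MazurRubin2004, §5.3 (principal Artinian coefficient rings)] -/
theorem bijective_frobeniusForm_of_finite [Finite R] (hg : g.Monic) (hd : 0 < g.natDegree) :
    Function.Bijective
      ((LinearMap.mul R (AdjoinRoot g)).compr₂
        ((Polynomial.lcoeff R (g.natDegree - 1)).comp (AdjoinRoot.modByMonicHom hg))) := by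
  classical
  set b := (AdjoinRoot.powerBasis' hg).basis with hb
  -- both sides are in bijection with `Fin d → R`
  have e₁ : AdjoinRoot g ≃ (Fin g.natDegree → R) := b.equivFun.toEquiv
  have e₂ : Module.Dual R (AdjoinRoot g) ≃ (Fin g.natDegree → R) := b.dualBasis.equivFun.toEquiv
  haveI : Finite (Module.Dual R (AdjoinRoot g)) := Finite.of_equiv _ e₂.symm
  haveI : Finite (AdjoinRoot g) := Finite.of_equiv _ e₁.symm
  exact (injective_frobeniusForm hg hd).bijective_of_nat_card_le
    (le_of_eq (by rw [Nat.card_congr e₁, Nat.card_congr e₂]))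

end Frobenius

/-! ## §2 `ann(ω̄) = (ω̄)` in `R[X]/(ω²)` for monic `ω` -/

section Annihilator

variable {R : Type*} [CommRing R] {ω : R[X]}

/-- **(R2)** For `ω` monic (hence a non-zero-divisor of `R[X]`) and any `f`: `ω̄ · f̄ = 0` in `R[X]/(ω²)` iff
`ω ∣ f`. [folklore] -/
theorem mk_mul_eq_zero_iff_dvd_of_monic (hω : ω.Monic) (f : R[X]) :
    AdjoinRoot.mk (ω ^ 2) ω * AdjoinRoot.mk (ω ^ 2) f = 0 ↔ ω ∣ f := by
  rw [← map_mul, AdjoinRoot.mk_eq_zero, pow_two]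
  constructor
  · rintro ⟨h, hh⟩
    refine ⟨h, hω.isRegular.left ?_⟩
    simp only
    rw [hh, mul_assoc]
  · rintro ⟨h, rfl⟩
    exact ⟨h, by ring⟩

/-- **(R2), element form:** `ω̄ · a = 0` in `R[X]/(ω²)` iff `a ∈ ω̄ · (R[X]/(ω²))`, i.e. the annihilator of `ω̄` is
the principal ideal `(ω̄)` (so `ω̄ A ≅ A/ω̄ A`). [folklore] -/
theorem annihilator_of_monic_sq (hω : ω.Monic) (a : AdjoinRoot (ω ^ 2)) :
    AdjoinRoot.mk (ω ^ 2) ω * a = 0 ↔ a ∈ Ideal.span {AdjoinRoot.mk (ω ^ 2) ω} := by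
  obtain ⟨f, rfl⟩ := AdjoinRoot.mk_surjective a
  rw [mk_mul_eq_zero_iff_dvd_of_monic hω, Ideal.mem_span_singleton]
  constructor
  · rintro ⟨h, rfl⟩
    exact ⟨AdjoinRoot.mk _ h, by rw [map_mul]⟩
  · rintro ⟨b, hb⟩
    obtain ⟨h, rfl⟩ := AdjoinRoot.mk_surjective b
    rw [← map_mul, AdjoinRoot.mk_eq_mk] at hb
    obtain ⟨c, hc⟩ := hb
    exact ⟨h + ω * c, by linear_combination hc⟩

end Annihilator

/-! ## §3 `a • M ≅ M / b • M` for free modules over a ring with `ann(a) = (b)`; `p^n • A ≅ A / p • A` -/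

section SMul

open scoped Pointwise

variable {R : Type*} [CommRing R] {M : Type*} [AddCommGroup M] [Module R M]

/-- **(R3), pointwise:** if `a x = 0 ↔ b ∣ x` in `R` and `M` is a free `R`-module, then `a • m = 0 ↔ m ∈ b • M`
(coordinates in a basis; `b • ⊤ = (b) • ⊤` by `Submodule.ideal_span_singleton_smul`). [folklore] -/
theorem smul_eq_zero_iff_mem_smul_top_of_free [Module.Free R M] {a b : R}
    (hab : ∀ x : R, a * x = 0 ↔ b ∣ x) (m : M) :
    a • m = 0 ↔ m ∈ b • (⊤ : Submodule R M) := by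
  classical
  let B := Module.Free.chooseBasis R M
  constructor
  · intro h
    -- every coordinate of `m` is divisible by `b`
    have hcoord : ∀ i, b ∣ B.repr m i := fun i => by
      rw [← hab]
      have := congrArg (fun v => B.repr v i) h
      simpa using this
    choose c hc using hcoord
    -- the finitely supported vector of quotients
    let c' : Module.Free.ChooseBasisIndex R M →₀ R :=
      Finsupp.onFinset (B.repr m).support (fun i => if i ∈ (B.repr m).support then c i else 0)
        (fun i hi => by
          by_contra hni
          exact hi (if_neg hni))
    have hc' : B.repr m = b • c' := by
      ext i
      simp only [c', Finsupp.coe_smul, Pi.smul_apply, Finsupp.onFinset_apply, smul_eq_mul]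
      split_ifs with hi
      · exact hc i
      · rw [mul_zero]
        exact Finsupp.notMem_support_iff.mp hi
    have hm : m = b • B.repr.symm c' := by
      apply B.repr.injective
      rw [map_smul, LinearEquiv.apply_symm_apply, hc']
    rw [hm]
    exact Submodule.smul_mem_pointwise_smul _ _ _ Submodule.mem_top
  · intro h
    rw [Submodule.mem_smul_pointwise_iff_exists] at h
    obtain ⟨m', -, rfl⟩ := h
    rw [smul_smul, (hab b).mpr (dvd_refl b), zero_smul]

/-- **(R3):** under the same hypotheses the kernel of `m ↦ a • m` (`LinearMap.lsmul R M a`) is `b • M`.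
[folklore] -/
theorem ker_lsmul_eq_smul_top_of_free [Module.Free R M] {a b : R} (hab : ∀ x : R, a * x = 0 ↔ b ∣ x) :
    LinearMap.ker (LinearMap.lsmul R M a) = b • (⊤ : Submodule R M) := by
  ext m
  rw [LinearMap.mem_ker, LinearMap.lsmul_apply]
  exact smul_eq_zero_iff_mem_smul_top_of_free hab m

/-- The range of multiplication by `a` is the submodule `a • M`. [folklore] -/
theorem range_lsmul_eq_smul_top (a : R) :
    LinearMap.range (LinearMap.lsmul R M a) = a • (⊤ : Submodule R M) := by
  ext m
  simp only [LinearMap.mem_range, LinearMap.lsmul_apply, Submodule.mem_smul_pointwise_iff_exists,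
    Submodule.mem_top, true_and]

/-- **(R3), as an isomorphism:** `M / b • M ≃ₗ[R] a • M` (quotient by the kernel of `a • ·` onto its range).
[folklore] -/
theorem nonempty_quotSMulTop_linearEquiv_smulTop [Module.Free R M] {a b : R}
    (hab : ∀ x : R, a * x = 0 ↔ b ∣ x) :
    Nonempty ((M ⧸ b • (⊤ : Submodule R M)) ≃ₗ[R] ↥(a • (⊤ : Submodule R M))) :=
  ⟨((Submodule.quotEquivOfEq _ _ (ker_lsmul_eq_smul_top_of_free (M := M) hab).symm).trans
      (LinearMap.quotKerEquivRange _)).trans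
    (LinearEquiv.ofEq _ _ (range_lsmul_eq_smul_top (M := M) a))⟩

/-- **`p^n x = 0 ↔ p ∣ x` in `ℤ/p^{n+1}`** (the hypothesis of (R3) for `A = Λ/(p^{n+1}, ω²)` over `R = ℤ/p^{n+1}`,
`a = p^n`, `b = p`: `p^n A ≅ A / pA = Ω/T^{2e}`). [folklore] -/
theorem ZMod.pow_mul_eq_zero_iff_dvd (p n : ℕ) (hp : p.Prime) (x : ZMod (p ^ (n + 1))) :
    (p : ZMod (p ^ (n + 1))) ^ n * x = 0 ↔ (p : ZMod (p ^ (n + 1))) ∣ x := by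
  haveI : NeZero (p ^ (n + 1)) := ⟨pow_ne_zero _ hp.ne_zero⟩
  constructor
  · intro h
    obtain ⟨v, rfl⟩ : ∃ v : ℕ, (v : ZMod (p ^ (n + 1))) = x := ⟨x.val, ZMod.natCast_zmod_val x⟩
    rw [← Nat.cast_pow, ← Nat.cast_mul, ZMod.natCast_eq_zero_iff, pow_succ] at h
    obtain ⟨c, hc⟩ := (Nat.mul_dvd_mul_iff_left (pow_pos hp.pos n)).mp h
    exact ⟨c, by rw [hc, Nat.cast_mul]⟩
  · rintro ⟨y, rfl⟩
    rw [← mul_assoc, ← pow_succ, ← Nat.cast_pow, ZMod.natCast_self, zero_mul]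

end SMul

end Summit.BirchSwinnertonDyer.BirchSwinnertonDyer.Rank1Residual.GradedRing
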